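import Summits.QuantumAdvantage.QuantumAdvantage.Theorems.SosSandwichQueryHomogeneousRung
import Summits.QuantumAdvantage.QuantumAdvantage.Theorems.SosSandwichOneQueryFrameAA
import Summits.QuantumAdvantage.QuantumAdvantage.Theorems.SosSandwichQueryAcceptPseudoBounded
import HarnessLib

/-!
# The `Q_T` child line of `PseudoBoundedAA`: LEVEL DESCENT INSIDE `Q_T` ⟹ AA_Q — composition with BOTH base rungs proved

Support theorem for route `SosSandwich`, crux `PseudoBoundedAA` (stmt-QuantumAdvantage-15237).  The registered birth
skeleton of the crux composes PB-AA (on the SOS class `K_T`) from a homogeneous rung and LEVEL DESCENT; on `K_T` the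
degree-free homogeneous rung is refuted and its T-lossy repair `HomogeneousPBAAT` is open.  On the sub-class `Q_T`
(acceptance probabilities of genuine `T`-query algorithms, the route's kill-criterion retreat) BOTH base rungs are
now theorems of the tree:

* `T' = 1`: `OneQueryFrameAA_proof` (`4 Var² ≤ 9 maxInf` on `K_1 ⊇ Q_1`, via `QueryAcceptPseudoBounded_proof`);
* top-homogeneous of order `T'`: `QueryTopLevel.queryHomogeneousRung` (`4 Var² ≤ maxInf`, Escudero Gutiérrez Cor 1.7).

This file proves the COMPOSITION for the `Q_T` line: `aaQuery_of_levelDescentQ` —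
LEVEL DESCENT INSIDE `Q_T` (every `T`-query acceptance polynomial with `Var ≥ ε` has a surrogate acceptance polynomial
of a `T'`-query algorithm, `1 ≤ T' ≤ T`, which is one-query or top-homogeneous of order `T'`, with
`Var ≥ A(ε/T)^a` and every influence at most `B ×` some influence of the original) implies AA_Q (the
Aaronson–Ambainis bound for quantum acceptance probabilities, hypothesis of
`QTRestrict.quantumQuerySimulable_of_aaQuery`, hence AA14 Conjecture 4) with `(c, C) = (2a, 4A²/(9B))`.
So the `Q_T` line is ONE-STUB: its only open piece is level descent inside `Q_T` (`LevelDescentQ`, written inline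
below; no new definition).  Honest label: composition/glue; the open piece is research-class.

Sources: EscuderoGutierrez2023 (arXiv:2304.06713) Cor 1.7, Question 4.5; AaronsonAmbainis2014 Conj. 6, Thm 7;
BealsEtAl2001 Lemma 4.1.
-/

noncomputable section

set_option linter.dupNamespace false

namespace Summit.QuantumAdvantage.QuantumAdvantage.Theorems.SosSandwich.QueryTopLevel

open Finset Literature.Computability.Cryptography Literature.Computability.QuantumComplexity
open Summit.QuantumAdvantage.QuantumAdvantage.Theses.SosSandwich

variable {N : ℕ}

/-- The route's `OneQueryFrameAA`, unpacked into the tree's cube vocabulary (definitional). [folklore] -/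
theorem oneQueryFrameAA_iff' :
    OneQueryFrameAA ↔
      ∀ (N : ℕ) (p : MvPolynomial (Fin N) ℝ),
        (∃ (m : ℕ) (q r : Fin m → MvPolynomial (Fin N) ℝ), (∀ j, (q j).totalDegree ≤ 1 ∧ (r j).totalDegree ≤ 1) ∧
          ∀ x : Fin N → Bool, evalBool p x = ∑ j, evalBool (q j) x ^ 2 ∧ 1 - evalBool p x = ∑ j, evalBool (r j) x ^ 2) →
        0 < boolVariance p → ∃ i : Fin N, 4 * boolVariance p ^ 2 ≤ 9 * influence i p :=
  Iff.rfl

/-- The route's `QueryAcceptPseudoBounded` (`Q_T ⊆ K_T`), unpacked (definitional). [folklore] -/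
theorem queryAcceptPseudoBounded_iff' :
    QueryAcceptPseudoBounded ↔
      ∀ (N : ℕ) (Q : QQueryAlg N), ∃ (m : ℕ) (q r : Fin m → MvPolynomial (Fin N) ℝ),
        (∀ j, (q j).totalDegree ≤ Q.queries ∧ (r j).totalDegree ≤ Q.queries) ∧
          ∀ x : Fin N → Bool, Q.acceptProb x = ∑ j, evalBool (q j) x ^ 2 ∧ 1 - Q.acceptProb x = ∑ j, evalBool (r j) x ^ 2 :=
  Iff.rfl

/-- **Base rung `T' = 1` on `Q_1`**: a one-query acceptance polynomial with positive variance has a variable with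
`4 Var² ≤ 9 Inf_i` (route support `OneQueryFrameAA` ∘ `QueryAcceptPseudoBounded`). [cite: EscuderoGutierrez2023, §1] -/
theorem oneQuery_influence (Q : QQueryAlg N) (hQ : Q.queries = 1) (q : MvPolynomial (Fin N) ℝ)
    (hq : ∀ x, evalBool q x = Q.acceptProb x) (hv : 0 < boolVariance q) :
    ∃ i : Fin N, 4 * boolVariance q ^ 2 ≤ 9 * influence i q := by
  obtain ⟨m, qs, rs, hdeg, hval⟩ := queryAcceptPseudoBounded_iff'.mp QueryAcceptPseudoBounded_proof N Q
  refine oneQueryFrameAA_iff'.mp OneQueryFrameAA_proof N q ⟨m, qs, rs, fun j => ?_, fun x => ?_⟩ hv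
  · rw [← hQ]; exact hdeg j
  · rw [hq x]; exact hval x

/-- **Both base rungs on `Q`**: a surrogate acceptance polynomial which is one-query OR top-homogeneous of its order
has a variable with `(4/9)·Var² ≤ Inf_i`. [cite: EscuderoGutierrez2023, Cor 1.7] -/
theorem baseClassQ_influence (Q : QQueryAlg N) (hT : 1 ≤ Q.queries) (q : MvPolynomial (Fin N) ℝ)
    (hq : ∀ x, evalBool q x = Q.acceptProb x)
    (hbase : Q.queries = 1 ∨ ∀ x : Fin N → Bool,
      ∑ i : Fin N, (evalBool q x - evalBool q (Function.update x i (!x i))) =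
        4 * (Q.queries : ℝ) * (evalBool q x - boolAvg (evalBool q)))
    (hv : 0 < boolVariance q) :
    ∃ i : Fin N, 4 / 9 * boolVariance q ^ 2 ≤ influence i q := by
  rcases hbase with h1 | hhom
  · obtain ⟨i, hi⟩ := oneQuery_influence Q h1 q hq hv
    exact ⟨i, by linarith⟩
  · obtain ⟨i, hi⟩ := queryHomogeneousRung Q hT q hq hhom
    refine ⟨i, le_trans ?_ hi⟩
    nlinarith [sq_nonneg (boolVariance q)]

/-- **LEVEL DESCENT INSIDE `Q_T` IMPLIES AA_Q.**  If every `T`-query acceptance polynomial `p` (`T ≥ 1`) with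
`Var[p] ≥ ε > 0` has a surrogate: an acceptance polynomial `q` of some `T'`-query algorithm (`1 ≤ T' ≤ T`, any
number of variables) which is one-query or top-homogeneous of order `T'`, with `Var[q] ≥ A (ε/T)^a` and every
influence of `q` at most `B` times some influence of `p` — then the Aaronson–Ambainis influence bound holds for all
quantum acceptance probabilities with `(c, C) = (2a, 4A²/(9B))` (shape of the hypothesis `AA_Q` of
`QTRestrict.quantumQuerySimulable_of_aaQuery`).  Both base rungs used are PROVED (`OneQueryFrameAA_proof`,
`queryHomogeneousRung`); the antecedent is the only open piece of the `Q_T` line. [cite: EscuderoGutierrez2023, Question 4.5] -/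
theorem aaQuery_of_levelDescentQ
    (hLD : ∃ (a : ℕ) (A B : ℝ), 0 < A ∧ 0 < B ∧
      ∀ (N : ℕ) (Q : QQueryAlg N) (p : MvPolynomial (Fin N) ℝ) (ε : ℝ),
        1 ≤ Q.queries → (∀ x, evalBool p x = Q.acceptProb x) → 0 < ε → ε ≤ boolVariance p →
        ∃ (N' : ℕ) (Q' : QQueryAlg N') (q : MvPolynomial (Fin N') ℝ),
          1 ≤ Q'.queries ∧ Q'.queries ≤ Q.queries ∧ (∀ x, evalBool q x = Q'.acceptProb x) ∧
          (Q'.queries = 1 ∨ ∀ x : Fin N' → Bool,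
            ∑ i : Fin N', (evalBool q x - evalBool q (Function.update x i (!x i))) =
              4 * (Q'.queries : ℝ) * (evalBool q x - boolAvg (evalBool q))) ∧
          A * (ε / Q.queries) ^ a ≤ boolVariance q ∧
          ∀ i : Fin N', ∃ i' : Fin N, influence i q ≤ B * influence i' p) :
    ∃ (c : ℕ) (C : ℝ), 0 < C ∧ ∀ (N : ℕ) (Q : QQueryAlg N) (p : MvPolynomial (Fin N) ℝ) (ε : ℝ),
      1 ≤ Q.queries → (∀ x, evalBool p x = Q.acceptProb x) → 0 < ε → ε ≤ boolVariance p →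
        ∃ i : Fin N, C * (ε / Q.queries) ^ c ≤ influence i p := by
  obtain ⟨a, A, B, hA, hB, hD⟩ := hLD
  refine ⟨2 * a, 4 / 9 * A ^ 2 / B, by positivity, fun N Q p ε hT hp hε hεv => ?_⟩
  obtain ⟨N', Q', q, hT'1, -, hq, hbase, hvar, hdom⟩ := hD N Q p ε hT hp hε hεv
  have hT0 : (0 : ℝ) < (Q.queries : ℝ) := by exact_mod_cast hT
  have hfloor : 0 < A * (ε / Q.queries) ^ a := mul_pos hA (pow_pos (div_pos hε hT0) a)
  have hvq : 0 < boolVariance q := lt_of_lt_of_le hfloor hvar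
  obtain ⟨i, hi⟩ := baseClassQ_influence Q' hT'1 q hq hbase hvq
  obtain ⟨i', hi'⟩ := hdom i
  refine ⟨i', ?_⟩
  have hsq_le : (A * (ε / Q.queries) ^ a) ^ 2 ≤ boolVariance q ^ 2 := pow_le_pow_left₀ hfloor.le hvar 2
  have step : 4 / 9 * A ^ 2 * (ε / Q.queries) ^ (2 * a) ≤ B * influence i' p := by
    calc 4 / 9 * A ^ 2 * (ε / Q.queries) ^ (2 * a)
        = 4 / 9 * (A * (ε / Q.queries) ^ a) ^ 2 := by rw [pow_mul']; ring
      _ ≤ 4 / 9 * boolVariance q ^ 2 := mul_le_mul_of_nonneg_left hsq_le (by norm_num)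
      _ ≤ influence i q := hi
      _ ≤ B * influence i' p := hi'
  have hrew : 4 / 9 * A ^ 2 / B * (ε / Q.queries) ^ (2 * a) =
      (4 / 9 * A ^ 2 * (ε / Q.queries) ^ (2 * a)) / B := by ring
  rw [hrew, div_le_iff₀ hB]
  linarith [step, mul_comm B (influence i' p)]

end Summit.QuantumAdvantage.QuantumAdvantage.Theorems.SosSandwich.QueryTopLevel

end
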